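import Mathlib
import Summits.Ventures.PercRepro.TriangleCapRowJ
import Summits.Ventures.PercRepro.TriangleCapRowA2FiveEvery

/-!
# PercRepro — EVERY ROW r = a + j WITH a ≥ j + 5, FOR EVERY a: the theorems of the source module re-derived WITHOUT the bound through
`below_second_order_every` (part 204b) in place of `below_second_order_all` (p3, gen 49; part 204c)

The proofs are those of the source module verbatim; the bound `a ≤ 18` entered them only through the `B2` regime
`below_second_order_all` of part 200zi (the corner `k = 2a + r`, now `below_corner_every`) and through the earlier
rows. Axioms: standard.
-/

namespace PercRepro

namespace TriangleCap

namespace C047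

open Finset

universe u

variable {V : Type*} [Fintype V] [DecidableEq V]

/-- **EVERY ROW `r = a + j`** (the induction form): for every `j`, every finite `K₄⁻`-free graph on `k ≥ 3a + j`
vertices with `a (k − a) − (a + j)` edges, `j + 5 ≤ a`, is `a`-bipartite or at least `2 (k − a − 3) + 2j (a − 2)`
below the closed form. -/
theorem rowJ_second_order_aux_every (j : ℕ) :
    ∀ (W : Type u) [Fintype W] [DecidableEq W] (D : SimpleGraph W) [DecidableRel D.Adj], K4mFree D →
      ∀ a : ℕ, j + 5 ≤ a → 3 * a + j ≤ Fintype.card W →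
        D.edgeFinset.card + (a + j) = a * (Fintype.card W - a) →
        (∃ A : Finset W, A.card = a ∧ BipSub D A) ∨
          ∑ v, deg D v * deg D v + (a + j) * (Fintype.card W - 1 - (a + j)) +
              (2 * (Fintype.card W - a - 3) + 2 * j * (a - 2)) ≤ D.edgeFinset.card * Fintype.card W := by
  induction j using Nat.strong_induction_on with
  | _ j ih =>
  intro W _ _ D _ hK a ha hk hm
  rcases Nat.lt_or_ge j 3 with hj3 | hj3
  · -- the rows `j = 0, 1, 2`
    interval_cases j
    · have hm0 : D.edgeFinset.card + a = a * (Fintype.card W - a) := by simpa using hm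
      rcases rowA_second_order_gen_every D hK a (by omega) (by omega) hm0 with h | h
      · exact Or.inl h
      · right
        have e1 : (a + 0) * (Fintype.card W - 1 - (a + 0)) = a * (Fintype.card W - 1 - a) := by simp
        have e2 : 2 * (Fintype.card W - a - 3) + 2 * 0 * (a - 2) = 2 * (Fintype.card W - a - 3) := by simp
        rw [e1, e2]
        exact h
    · rcases rowA1_second_order_gen''_every D hK a (by omega) (by omega) hm with h | h
      · exact Or.inl h
      · right
        have e2 : 2 * (Fintype.card W - a - 3) + 2 * 1 * (a - 2) = 2 * Fintype.card W - 10 := by omega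
        rw [e2]
        exact h
    · rcases rowA2_second_order_gen_every D hK a (by omega) (by omega) hm with h | h
      · exact Or.inl h
      · right
        have e2 : 2 * (Fintype.card W - a - 3) + 2 * 2 * (a - 2) = 2 * Fintype.card W + 2 * a - 14 := by omega
        rw [e2]
        exact h
  · -- `j ≥ 3`
    have hk2 : 2 * a + 2 ≤ Fintype.card W := by omega
    -- (A) a vertex at the cap
    by_cases hx : ∃ x, deg D x + a = Fintype.card W
    · obtain ⟨x, hx⟩ := hx
      exact cap_Aj_gen D hK a j (by omega) hk hm x hx
    push Not at hx
    have hcap : ∀ v, deg D v + a ≤ Fintype.card W := fun v =>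
      deg_add_le_card_of_dense D hK a (by omega) (by omega)
        (cap_arith a (Fintype.card W) D.edgeFinset.card (a + j) (by omega) (by omega)
          (below_cap_arith a (Fintype.card W) D.edgeFinset.card (a + j) (by omega) hm)) v
    have hcap' : ∀ v, deg D v + a + 1 ≤ Fintype.card W := fun v => by
      have h1 := hcap v
      have h2 := hx v
      omega
    have hcap2 : ∀ v, deg D v ≤ (Fintype.card W - a - 2) + 1 := fun v => by have := hcap' v; omega
    -- (B) every degree `≥ a`: the window
    by_cases hdeg : ∀ v, a ≤ deg D v
    · exact Or.inr (rowJ_window D a j ha hk hm hcap' hdeg)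
    push Not at hdeg
    obtain ⟨z, hz⟩ := hdeg
    -- (C) the deletion bookkeeping: `D − z` on `(k − 1, a, d + j)`
    have hK' := k4mFree_del D hK z
    have hcard' := card_del z
    have hedges' := card_edges_del D z
    have hsq := sum_deg_sq_del D z
    have hT := sum_del_nbhd_le D z (Fintype.card W - a - 2) hcap2
    obtain ⟨T, hTdef⟩ : ∃ T, ∑ w : {v : W // v ≠ z}, (if D.Adj w.1 z then deg (del D z) w else 0) = T := ⟨_, rfl⟩
    obtain ⟨S', hS'def⟩ : ∃ S', ∑ w : {v : W // v ≠ z}, deg (del D z) w * deg (del D z) w = S' := ⟨_, rfl⟩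
    obtain ⟨m', hm'def⟩ : ∃ m', (del D z).edgeFinset.card = m' := ⟨_, rfl⟩
    rw [hTdef, hS'def] at hsq
    rw [hTdef] at hT
    rw [hm'def] at hedges'
    have hcardV' : Fintype.card {v : W // v ≠ z} = Fintype.card W - 1 := by omega
    have hm' : (del D z).edgeFinset.card + (deg D z + j) = a * (Fintype.card {v : W // v ≠ z} - a) := by
      rw [hm'def, hcardV']
      exact below_cell_edges a (a + j) (deg D z + j) (deg D z) (Fintype.card W) D.edgeFinset.card m' hk2 (by omega)
        hedges' hm
    have hmd : m' + deg D z + (a + j) = a * (Fintype.card W - a) := by omega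
    have hfin : S' + 2 * T + deg D z + deg D z * deg D z + (a + j) * (Fintype.card W - 1 - (a + j)) +
          (2 * (Fintype.card W - a - 3) + 2 * j * (a - 2)) ≤ (m' + deg D z) * Fintype.card W →
        ∑ v, deg D v * deg D v + (a + j) * (Fintype.card W - 1 - (a + j)) +
            (2 * (Fintype.card W - a - 3) + 2 * j * (a - 2)) ≤ D.edgeFinset.card * Fintype.card W := by
      intro h
      rw [hsq, ← hedges']
      exact h
    -- the `a`-bipartite alternative of `D − z`: the uniform mixed reads
    have hbip : ∀ A' : Finset {v : W // v ≠ z}, A'.card = a → BipSub (del D z) A' →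
        (∃ A : Finset W, A.card = a ∧ BipSub D A) ∨
          (∑ v, deg D v * deg D v + (a + j) * (Fintype.card W - 1 - (a + j)) +
              (2 * (Fintype.card W - a - 3) + 2 * j * (a - 2)) ≤ D.edgeFinset.card * Fintype.card W) := by
      intro A' hA'card hB
      rcases sides_J_gen D a j ha hk hm z (by omega) A' hA'card hB hm' hcap2 with h | h |
        ⟨hd2, ⟨w₀, hw₀A, hw₀z⟩, ⟨w₁, hw₁A, hw₁z⟩, hTcrude⟩
      · exact Or.inl h
      · exact Or.inr h
      · right
        apply hfin
        rw [hTdef] at hTcrude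
        rcases Nat.lt_or_ge (deg D z) 3 with hd3 | hd3
        · -- `d = 2`: the crude read
          have hd : deg D z = 2 := by omega
          have hS := sum_deg_sq_le_of_bipSub (del D z) A' hB a (deg D z + j) hA'card hm' (by omega)
          rw [hS'def, hm'def, hcardV'] at hS
          rw [hd] at hS hTcrude hmd ⊢
          have hTc : T ≤ (Fintype.card W - a - 2) + a := by omega
          exact rowJ_mixed_two a j (Fintype.card W) m' S' T ha hk hmd hS hTc
        · -- `d ≥ 3`: the vertex bound at `w₀`
          obtain ⟨t, s₀, x, hts, ht1, hs₀1, htx, hxr, hxa, hS, hT1, hT2⟩ :=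
            mixed_vertex_core D hK a (by omega) z A' hA'card hB (deg D z + j) (by omega) hm' hcap2 w₀ hw₀A hw₀z
              w₁ hw₁A hw₁z
          rw [hS'def, hm'def, hcardV'] at hS
          rw [hTdef] at hT1 hT2
          have hda : deg D z + 1 ≤ a := by omega
          -- the combined reads at the actual `x`
          have hC1 : S' + 2 * T + (deg D z + j) * (Fintype.card W - 1 - 1 - (deg D z + j)) +
              (2 * ((deg D z + j - x) * (x - 1)) + 2 * x) ≤
              m' * (Fintype.card W - 1) + 2 * (t * (Fintype.card W - a - 2)) + 2 * a +
                2 * ((s₀ - 1) * (a + 1 - t)) := by omega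
          have hC2 : S' + 2 * T + (deg D z + j) * (Fintype.card W - 1 - 1 - (deg D z + j)) +
              (2 * ((deg D z + j - x) * (x - 1)) + 2 * x) ≤
              m' * (Fintype.card W - 1) + 2 * (t * (Fintype.card W - a - s₀)) + 2 * a +
                2 * ((s₀ - 1) * (a + 1 - t)) := by omega
          -- the endpoint `hi = min (d + j, a)`
          by_cases hsa : deg D z + j ≤ a
          · rcases concave_endpoint' (deg D z + j) (t - 1) (deg D z + j) x (by omega) hxr (le_refl _) with hg | hg
            · rcases Nat.lt_or_ge s₀ 2 with hs₀ | hs₀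
              · -- a single off-side neighbour, `x = t − 1`
                have hs₀' : s₀ = 1 := by omega
                have hST : S' + 2 * T + (deg D z + j) * (Fintype.card W - 1 - 1 - (deg D z + j)) +
                    (2 * ((deg D z + j - (t - 1)) * (t - 1 - 1)) + 2 * (t - 1)) ≤
                    m' * (Fintype.card W - 1) + 2 * ((deg D z - 1) * (Fintype.card W - a - 2)) + 2 * a := by
                  rw [hs₀'] at hC1
                  have ht : t = deg D z - 1 := by omega
                  rw [ht] at hC1 hg ⊢
                  simp only [Nat.sub_self, zero_mul, mul_zero, add_zero] at hC1
                  omega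
                exact rowJ_one_lo a j (deg D z) (t - 1) (Fintype.card W) m' S' T ha hk hd3 hda (by omega) hmd hST
              · have hST : S' + 2 * T + (deg D z + j) * (Fintype.card W - 1 - 1 - (deg D z + j)) +
                    (2 * ((deg D z + j - (t - 1)) * (t - 1 - 1)) + 2 * (t - 1)) ≤
                    m' * (Fintype.card W - 1) + 2 * (t * (Fintype.card W - a - s₀)) + 2 * a +
                      2 * ((s₀ - 1) * (a + 1 - t)) := by omega
                exact rowJ_two_lo a j (deg D z) t s₀ (t - 1) (Fintype.card W) m' S' T ha hk hd3 hda hts ht1 hs₀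
                  (by omega) hmd hST
            · rcases Nat.lt_or_ge s₀ 2 with hs₀ | hs₀
              · have hs₀' : s₀ = 1 := by omega
                have hST : S' + 2 * T + (deg D z + j) * (Fintype.card W - 1 - 1 - (deg D z + j)) +
                    (2 * ((deg D z + j - (deg D z + j)) * (deg D z + j - 1)) + 2 * (deg D z + j)) ≤
                    m' * (Fintype.card W - 1) + 2 * ((deg D z - 1) * (Fintype.card W - a - 2)) + 2 * a := by
                  rw [hs₀'] at hC1
                  have ht : t = deg D z - 1 := by omega
                  rw [ht] at hC1
                  simp only [Nat.sub_self, zero_mul, mul_zero, add_zero] at hC1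
                  omega
                exact rowJ_one_hi_s a j (deg D z) (deg D z + j) (Fintype.card W) m' S' T ha hk hd3 hda hsa rfl hmd
                  hST
              · have hST : S' + 2 * T + (deg D z + j) * (Fintype.card W - 1 - 1 - (deg D z + j)) +
                    (2 * ((deg D z + j - (deg D z + j)) * (deg D z + j - 1)) + 2 * (deg D z + j)) ≤
                    m' * (Fintype.card W - 1) + 2 * (t * (Fintype.card W - a - s₀)) + 2 * a +
                      2 * ((s₀ - 1) * (a + 1 - t)) := by omega
                exact rowJ_two_hi_s a j (deg D z) t s₀ (deg D z + j) (Fintype.card W) m' S' T ha hk hd3 hda hts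
                  ht1 hs₀ hsa rfl hmd hST
          · push Not at hsa
            rcases concave_endpoint' (deg D z + j) (t - 1) a x (by omega) hxa (by omega) with hg | hg
            · rcases Nat.lt_or_ge s₀ 2 with hs₀ | hs₀
              · have hs₀' : s₀ = 1 := by omega
                have hST : S' + 2 * T + (deg D z + j) * (Fintype.card W - 1 - 1 - (deg D z + j)) +
                    (2 * ((deg D z + j - (t - 1)) * (t - 1 - 1)) + 2 * (t - 1)) ≤
                    m' * (Fintype.card W - 1) + 2 * ((deg D z - 1) * (Fintype.card W - a - 2)) + 2 * a := by
                  rw [hs₀'] at hC1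
                  have ht : t = deg D z - 1 := by omega
                  rw [ht] at hC1 hg ⊢
                  simp only [Nat.sub_self, zero_mul, mul_zero, add_zero] at hC1
                  omega
                exact rowJ_one_lo a j (deg D z) (t - 1) (Fintype.card W) m' S' T ha hk hd3 hda (by omega) hmd hST
              · have hST : S' + 2 * T + (deg D z + j) * (Fintype.card W - 1 - 1 - (deg D z + j)) +
                    (2 * ((deg D z + j - (t - 1)) * (t - 1 - 1)) + 2 * (t - 1)) ≤
                    m' * (Fintype.card W - 1) + 2 * (t * (Fintype.card W - a - s₀)) + 2 * a +
                      2 * ((s₀ - 1) * (a + 1 - t)) := by omega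
                exact rowJ_two_lo a j (deg D z) t s₀ (t - 1) (Fintype.card W) m' S' T ha hk hd3 hda hts ht1 hs₀
                  (by omega) hmd hST
            · rcases Nat.lt_or_ge s₀ 2 with hs₀ | hs₀
              · have hs₀' : s₀ = 1 := by omega
                have hST : S' + 2 * T + (deg D z + j) * (Fintype.card W - 1 - 1 - (deg D z + j)) +
                    (2 * ((deg D z + j - a) * (a - 1)) + 2 * a) ≤
                    m' * (Fintype.card W - 1) + 2 * ((deg D z - 1) * (Fintype.card W - a - 2)) + 2 * a := by
                  rw [hs₀'] at hC1
                  have ht : t = deg D z - 1 := by omega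
                  rw [ht] at hC1
                  simp only [Nat.sub_self, zero_mul, mul_zero, add_zero] at hC1
                  omega
                exact rowJ_one_hi_a a j (deg D z) a (Fintype.card W) m' S' T ha hk hd3 hda (by omega) rfl hmd hST
              · have hST : S' + 2 * T + (deg D z + j) * (Fintype.card W - 1 - 1 - (deg D z + j)) +
                    (2 * ((deg D z + j - a) * (a - 1)) + 2 * a) ≤
                    m' * (Fintype.card W - 1) + 2 * (t * (Fintype.card W - a - s₀)) + 2 * a +
                      2 * ((s₀ - 1) * (a + 1 - t)) := by omega
                exact rowJ_two_hi_a a j (deg D z) t s₀ a (Fintype.card W) m' S' T ha hk hd3 hda hts ht1 hs₀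
                  (by omega) rfl hmd hST
    -- (D) the cell of `D − z`
    rcases Nat.lt_or_ge (deg D z + j + 2) a with hs3 | hs3
    · -- `d + j ≤ a − 3`: a `B2` cell
      rcases below_second_order_every (del D z) hK' a (deg D z + j) (by omega) (by omega) (by omega) hm'
        with ⟨A', hA'card, hB⟩ | hgap
      · exact hbip A' hA'card hB
      · right
        apply hfin
        rw [hS'def, hm'def, hcardV'] at hgap
        exact rowJ_del_B2 a j (deg D z) (Fintype.card W) m' S' T (by omega) hk hmd hgap hT
    · rcases Nat.lt_or_ge (deg D z + j + 1) a with hs2 | hs2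
      · -- `d + j = a − 2`: the `T` cell
        have hs : deg D z + j = a - 2 := by omega
        have hm'' : (del D z).edgeFinset.card + (a - 2) = a * (Fintype.card {v : W // v ≠ z} - a) := by
          rw [← hs]; exact hm'
        rcases rowT_second_order_gen_every (del D z) hK' a (a - 2) (by omega) (by omega) (by omega) hm''
          with ⟨A', hA'card, hB⟩ | hgap
        · exact hbip A' hA'card hB
        · right
          apply hfin
          rw [hS'def, hm'def, hcardV'] at hgap
          exact rowJ_del_T a j (deg D z) (Fintype.card W) m' S' T ha (by omega) hk hmd hgap hT
      · rcases Nat.lt_or_ge (deg D z + j) a with hs1 | hs1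
        · -- `d + j = a − 1`: the `B2` cell `r = a − 1`
          have hs : deg D z + j = a - 1 := by omega
          have hm'' : (del D z).edgeFinset.card + (a - 1) = a * (Fintype.card {v : W // v ≠ z} - a) := by
            rw [← hs]; exact hm'
          rcases rowB_second_order_all_every (del D z) hK' a (a - 1) (by omega) (by omega) (by omega) hm''
            with ⟨A', hA'card, hB⟩ | hgap
          · exact hbip A' hA'card hB
          · right
            apply hfin
            rw [hS'def, hm'def, hcardV'] at hgap
            exact rowJ_del_B a j (deg D z) (Fintype.card W) m' S' T ha (by omega) hk hmd hgap hT
        · -- `d + j = a + j′`, `j′ ≤ j − 1`: the induction hypothesis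
          obtain ⟨j', hj'⟩ : ∃ j', deg D z + j = a + j' := ⟨deg D z + j - a, by omega⟩
          have hj'lt : j' < j := by omega
          have hm'' : (del D z).edgeFinset.card + (a + j') = a * (Fintype.card {v : W // v ≠ z} - a) := by
            rw [← hj']; exact hm'
          rcases ih j' hj'lt {v : W // v ≠ z} (del D z) hK' a (by omega) (by omega) hm''
            with ⟨A', hA'card, hB⟩ | hgap
          · exact hbip A' hA'card hB
          · right
            apply hfin
            rw [hS'def, hm'def, hcardV'] at hgap
            exact rowJ_del_up a j (deg D z) j' (Fintype.card W) m' S' T ha hj' (by omega) hk hmd hgap hT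

/-- **EVERY ROW `r = a + j` OF THE STABILITY TABLE, `j + 5 ≤ a`, `3a + j ≤ k`:** `K₄⁻`-free,
`m + (a + j) = a (k − a)` ⇒ `a`-bipartite or `Σ_v d(v)² + (a + j)(k − 1 − (a + j)) + (2 (k − a − 3) + 2j (a − 2)) ≤ m k`. -/
theorem rowJ_second_order_every (D : SimpleGraph V) [DecidableRel D.Adj] (hK : K4mFree D) (a j : ℕ)
    (ha : j + 5 ≤ a) (hk : 3 * a + j ≤ Fintype.card V)
    (hm : D.edgeFinset.card + (a + j) = a * (Fintype.card V - a)) :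
    (∃ A : Finset V, A.card = a ∧ BipSub D A) ∨
      ∑ v, deg D v * deg D v + (a + j) * (Fintype.card V - 1 - (a + j)) +
          (2 * (Fintype.card V - a - 3) + 2 * j * (a - 2)) ≤ D.edgeFinset.card * Fintype.card V :=
  rowJ_second_order_aux_every j V D hK a ha hk hm

end C047

end TriangleCap

end PercRepro
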